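import Mathlib
import Summits.Ventures.PercRepro2.LeafRowPendantRootFO

/-!
# Row (LEAF-½) at a pendant root: the first-order mirror (B)-term is nonnegative, hence `B1h ≥ 0`,
hence the degree-one-root contraction of the row modulo `B2h`
(blind cell PercRepro2, p5 g29; `proofs/P5-OEDGE.md` §39 (12))

The mirror (B)-term `crossB p ends o a₂ a₁ v b` is a homogeneous cubic form in eight pattern masses
(`crossBPoly`), affine along the root edge, hence a cubic in `t = p e` in the Bernstein basis
(`crossB'_pin_cubic`, polarisations `B1c`, `B2c`); at a pendant root its closed pin vanishes
(`crossB'_closed_eq_zero`) and its one-copy coefficient is the first-order piece `crossB'fo` of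
`LeafRowPendantRootFO.lean` (`B1c_eq_crossB'fo`).  Theorem (B) (`LeafHalfCross.crossB_nonneg`)
holds at EVERY weight of the root edge, so `t · [(1 − t)²B1c + t(1 − t)B2c + t²·crossB′(p[e↦1])] ≥ 0`
for `t ∈ (0, 1]`, and a quadratic nonnegative on `(0, 1]` has a nonnegative constant term
(`nonneg_of_quadratic_nonneg`): **`crossB'fo_nonneg_pendant_root`** — the one global step of the
first-order row at a pendant root.  With the four pointwise pieces:

* **`B1h_nonneg_pendant_root`**: the one-copy Bernstein coefficient of `R½` at a pendant root edge
  is nonnegative — the first-order (PROOT-½) is a THEOREM;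
* **`LeafRow_pendant_root_of_B2h`**: the row at the contraction (`a₂ := z`, the open pin) together
  with `0 ≤ B2h` at the edge gives the row at the pendant instance for every weight of the edge —
  the two-copy coefficient `B2h ≥ 0` at pendant root edges is the one open inequality of the class
  (census 0 violations; `P5-OEDGE.md` §39 (8), (11)); it is NOT claimed here.
Own work; standard axioms.
-/

namespace Summit.Ventures.PercRepro2

open UnionCluster CovForm CovForm.FirstOrder CovForm.EdgeLine LeafStep LeafHalfCross
  LeafRowEdgeCubic LeafRowFirstOrderA LeafRowPendantRootFO

namespace LeafRowPendantRootB

/-- A quadratic `a(1−t)² + bt(1−t) + ct²` nonnegative on `(0, 1]` has `a ≥ 0`. -/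
lemma nonneg_of_quadratic_nonneg {R : Type*} [Field R] [LinearOrder R] [IsStrictOrderedRing R]
    {a b c : R}
    (h : ∀ t : R, 0 < t → t ≤ 1 → 0 ≤ a * (1 - t) ^ 2 + b * (t * (1 - t)) + c * t ^ 2) :
    0 ≤ a := by
  by_contra ha
  push Not at ha
  have hM0 : 0 < |b| + |c| + 1 := by positivity
  have hd : 0 < -a / (8 * (|b| + |c| + 1)) := div_pos (by linarith) (by positivity)
  obtain ⟨t, ht0, ht2, ht3⟩ : ∃ t : R, 0 < t ∧ t ≤ 1 / 2 ∧ t ≤ -a / (8 * (|b| + |c| + 1)) :=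
    ⟨min (1 / 2) (-a / (8 * (|b| + |c| + 1))), lt_min (by norm_num) hd, min_le_left _ _,
      min_le_right _ _⟩
  have ht1 : t ≤ 1 := by linarith
  have h1 := h t ht0 ht1
  have htt : 0 ≤ t * (1 - t) := mul_nonneg ht0.le (by linarith)
  have hb : b * (t * (1 - t)) ≤ |b| * t := by
    have e1 : b * (t * (1 - t)) ≤ |b| * (t * (1 - t)) :=
      mul_le_mul_of_nonneg_right (le_abs_self b) htt
    have e2 : |b| * (t * (1 - t)) ≤ |b| * t :=
      mul_le_mul_of_nonneg_left (mul_le_of_le_one_right ht0.le (by linarith)) (abs_nonneg b)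
    linarith
  have hc : c * t ^ 2 ≤ |c| * t := by
    have e1 : c * t ^ 2 ≤ |c| * t ^ 2 := mul_le_mul_of_nonneg_right (le_abs_self c) (by positivity)
    have e2 : |c| * t ^ 2 ≤ |c| * t := by
      have e3 : t ^ 2 ≤ t := by
        rw [sq]
        exact mul_le_of_le_one_right ht0.le ht1
      exact mul_le_mul_of_nonneg_left e3 (abs_nonneg c)
    linarith
  have hq : a * (1 - t) ^ 2 ≤ a * (1 / 4) := by
    have e1 : (1 / 4 : R) ≤ (1 - t) ^ 2 := by
      have e3 : (1 / 2 : R) ≤ 1 - t := by linarith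
      have e4 := pow_le_pow_left₀ (by norm_num : (0 : R) ≤ 1 / 2) e3 2
      norm_num at e4
      linarith
    exact mul_le_mul_of_nonpos_left e1 ha.le
  have htM : t * (|b| + |c| + 1) ≤ -a / 8 := by
    calc t * (|b| + |c| + 1) ≤ (-a / (8 * (|b| + |c| + 1))) * (|b| + |c| + 1) :=
          mul_le_mul_of_nonneg_right ht3 hM0.le
      _ = -a / 8 := by field_simp
  linarith [abs_nonneg b, abs_nonneg c]


section Cubic

variable {R : Type*} [Field R]

/-- The mirror (B)-term as a polynomial in its eight pattern masses. -/
def crossBPoly (Q x1 x2 x12 y1 y12 yx1 yx12 : R) : R :=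
  Q * (x1 * x2 - Q * x12) + x1 * (y1 * x2 - Q * y12) - (Q * x2 * yx1 - Q ^ 2 * yx12)

/-- The one-copy polarisation of `crossBPoly`. -/
def B1cPoly (Q₀ x1₀ x2₀ x12₀ y1₀ y12₀ yx1₀ yx12₀ Q₁ x1₁ x2₁ x12₁ y1₁ y12₁ yx1₁ yx12₁ : R) : R :=
  (Q₁ * x1₀ * x2₀ + Q₀ * x1₁ * x2₀ + Q₀ * x1₀ * x2₁) -
    (Q₁ * Q₀ * x12₀ + Q₀ * Q₁ * x12₀ + Q₀ * Q₀ * x12₁) +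
    (x1₁ * y1₀ * x2₀ + x1₀ * y1₁ * x2₀ + x1₀ * y1₀ * x2₁) -
    (x1₁ * Q₀ * y12₀ + x1₀ * Q₁ * y12₀ + x1₀ * Q₀ * y12₁) -
    (Q₁ * x2₀ * yx1₀ + Q₀ * x2₁ * yx1₀ + Q₀ * x2₀ * yx1₁) +
    (Q₁ * Q₀ * yx12₀ + Q₀ * Q₁ * yx12₀ + Q₀ * Q₀ * yx12₁)

/-- The two-copy polarisation of `crossBPoly`. -/
def B2cPoly (Q₀ x1₀ x2₀ x12₀ y1₀ y12₀ yx1₀ yx12₀ Q₁ x1₁ x2₁ x12₁ y1₁ y12₁ yx1₁ yx12₁ : R) : R :=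
  (Q₁ * x1₁ * x2₀ + Q₁ * x1₀ * x2₁ + Q₀ * x1₁ * x2₁) -
    (Q₁ * Q₁ * x12₀ + Q₁ * Q₀ * x12₁ + Q₀ * Q₁ * x12₁) +
    (x1₁ * y1₁ * x2₀ + x1₁ * y1₀ * x2₁ + x1₀ * y1₁ * x2₁) -
    (x1₁ * Q₁ * y12₀ + x1₁ * Q₀ * y12₁ + x1₀ * Q₁ * y12₁) -
    (Q₁ * x2₁ * yx1₀ + Q₁ * x2₀ * yx1₁ + Q₀ * x2₁ * yx1₁) +
    (Q₁ * Q₁ * yx12₀ + Q₁ * Q₀ * yx12₁ + Q₀ * Q₁ * yx12₁)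

/-- The Bernstein expansion of `crossBPoly` along a line. -/
lemma crossBPoly_pin (t Q₀ x1₀ x2₀ x12₀ y1₀ y12₀ yx1₀ yx12₀ Q₁ x1₁ x2₁ x12₁ y1₁ y12₁ yx1₁ yx12₁ : R) :
    crossBPoly (t * Q₁ + (1 - t) * Q₀) (t * x1₁ + (1 - t) * x1₀) (t * x2₁ + (1 - t) * x2₀)
      (t * x12₁ + (1 - t) * x12₀) (t * y1₁ + (1 - t) * y1₀) (t * y12₁ + (1 - t) * y12₀)
      (t * yx1₁ + (1 - t) * yx1₀) (t * yx12₁ + (1 - t) * yx12₀) =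
    (1 - t) ^ 3 * crossBPoly Q₀ x1₀ x2₀ x12₀ y1₀ y12₀ yx1₀ yx12₀ +
      t * (1 - t) ^ 2 * B1cPoly Q₀ x1₀ x2₀ x12₀ y1₀ y12₀ yx1₀ yx12₀ Q₁ x1₁ x2₁ x12₁ y1₁ y12₁ yx1₁ yx12₁ +
      t ^ 2 * (1 - t) * B2cPoly Q₀ x1₀ x2₀ x12₀ y1₀ y12₀ yx1₀ yx12₀ Q₁ x1₁ x2₁ x12₁ y1₁ y12₁ yx1₁ yx12₁ +
      t ^ 3 * crossBPoly Q₁ x1₁ x2₁ x12₁ y1₁ y12₁ yx1₁ yx12₁ := by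
  unfold crossBPoly B1cPoly B2cPoly
  ring

end Cubic

section Masses

variable {V : Type*} {E : Type*} [Fintype E] [DecidableEq E] {R : Type*} [Field R]

/-- The mirror (B)-term is `crossBPoly` of its eight masses. -/
lemma crossB'_eq_poly (p : E → R) (ends : E → Sym2 V) (o a₁ a₂ v b : V) :
    crossB p ends o a₂ a₁ v b = crossBPoly (prob p (avoidAll ends a₁ {a₂}))
      (prob p (avoidAll ends a₁ {a₂} ∩ connEvent ends a₁ o))
      (prob p (avoidAll ends a₁ {a₂} ∩ connEvent ends a₂ b))
      (prob p (avoidAll ends a₁ {a₂} ∩ (connEvent ends a₁ o ∩ connEvent ends a₂ b)))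
      (prob p (avoidAll ends a₁ {a₂} ∩ connEvent ends a₁ v))
      (prob p (avoidAll ends a₁ {a₂} ∩ (connEvent ends a₁ v ∩ connEvent ends a₂ b)))
      (prob p (avoidAll ends a₁ {a₂} ∩ (connEvent ends a₁ v ∩ connEvent ends a₁ o)))
      (prob p (avoidAll ends a₁ {a₂} ∩ (connEvent ends a₁ v ∩ (connEvent ends a₁ o ∩ connEvent ends a₂ b)))) := by
  unfold crossB anticov crossBPoly
  ring

/-- The one-copy Bernstein coefficient of the mirror (B)-term along `e`. -/
noncomputable def B1c (p : E → R) (ends : E → Sym2 V) (o a₁ a₂ v b : V) (e : E) : R :=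
  B1cPoly (prob (Function.update p e 0) (avoidAll ends a₁ {a₂}))
    (prob (Function.update p e 0) (avoidAll ends a₁ {a₂} ∩ connEvent ends a₁ o))
    (prob (Function.update p e 0) (avoidAll ends a₁ {a₂} ∩ connEvent ends a₂ b))
    (prob (Function.update p e 0) (avoidAll ends a₁ {a₂} ∩ (connEvent ends a₁ o ∩ connEvent ends a₂ b)))
    (prob (Function.update p e 0) (avoidAll ends a₁ {a₂} ∩ connEvent ends a₁ v))
    (prob (Function.update p e 0) (avoidAll ends a₁ {a₂} ∩ (connEvent ends a₁ v ∩ connEvent ends a₂ b)))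
    (prob (Function.update p e 0) (avoidAll ends a₁ {a₂} ∩ (connEvent ends a₁ v ∩ connEvent ends a₁ o)))
    (prob (Function.update p e 0) (avoidAll ends a₁ {a₂} ∩ (connEvent ends a₁ v ∩ (connEvent ends a₁ o ∩ connEvent ends a₂ b))))
    (prob (Function.update p e 1) (avoidAll ends a₁ {a₂}))
    (prob (Function.update p e 1) (avoidAll ends a₁ {a₂} ∩ connEvent ends a₁ o))
    (prob (Function.update p e 1) (avoidAll ends a₁ {a₂} ∩ connEvent ends a₂ b))
    (prob (Function.update p e 1) (avoidAll ends a₁ {a₂} ∩ (connEvent ends a₁ o ∩ connEvent ends a₂ b)))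
    (prob (Function.update p e 1) (avoidAll ends a₁ {a₂} ∩ connEvent ends a₁ v))
    (prob (Function.update p e 1) (avoidAll ends a₁ {a₂} ∩ (connEvent ends a₁ v ∩ connEvent ends a₂ b)))
    (prob (Function.update p e 1) (avoidAll ends a₁ {a₂} ∩ (connEvent ends a₁ v ∩ connEvent ends a₁ o)))
    (prob (Function.update p e 1) (avoidAll ends a₁ {a₂} ∩ (connEvent ends a₁ v ∩ (connEvent ends a₁ o ∩ connEvent ends a₂ b))))

/-- The two-copy Bernstein coefficient of the mirror (B)-term along `e`. -/
noncomputable def B2c (p : E → R) (ends : E → Sym2 V) (o a₁ a₂ v b : V) (e : E) : R :=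
  B2cPoly (prob (Function.update p e 0) (avoidAll ends a₁ {a₂}))
    (prob (Function.update p e 0) (avoidAll ends a₁ {a₂} ∩ connEvent ends a₁ o))
    (prob (Function.update p e 0) (avoidAll ends a₁ {a₂} ∩ connEvent ends a₂ b))
    (prob (Function.update p e 0) (avoidAll ends a₁ {a₂} ∩ (connEvent ends a₁ o ∩ connEvent ends a₂ b)))
    (prob (Function.update p e 0) (avoidAll ends a₁ {a₂} ∩ connEvent ends a₁ v))
    (prob (Function.update p e 0) (avoidAll ends a₁ {a₂} ∩ (connEvent ends a₁ v ∩ connEvent ends a₂ b)))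
    (prob (Function.update p e 0) (avoidAll ends a₁ {a₂} ∩ (connEvent ends a₁ v ∩ connEvent ends a₁ o)))
    (prob (Function.update p e 0) (avoidAll ends a₁ {a₂} ∩ (connEvent ends a₁ v ∩ (connEvent ends a₁ o ∩ connEvent ends a₂ b))))
    (prob (Function.update p e 1) (avoidAll ends a₁ {a₂}))
    (prob (Function.update p e 1) (avoidAll ends a₁ {a₂} ∩ connEvent ends a₁ o))
    (prob (Function.update p e 1) (avoidAll ends a₁ {a₂} ∩ connEvent ends a₂ b))
    (prob (Function.update p e 1) (avoidAll ends a₁ {a₂} ∩ (connEvent ends a₁ o ∩ connEvent ends a₂ b)))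
    (prob (Function.update p e 1) (avoidAll ends a₁ {a₂} ∩ connEvent ends a₁ v))
    (prob (Function.update p e 1) (avoidAll ends a₁ {a₂} ∩ (connEvent ends a₁ v ∩ connEvent ends a₂ b)))
    (prob (Function.update p e 1) (avoidAll ends a₁ {a₂} ∩ (connEvent ends a₁ v ∩ connEvent ends a₁ o)))
    (prob (Function.update p e 1) (avoidAll ends a₁ {a₂} ∩ (connEvent ends a₁ v ∩ (connEvent ends a₁ o ∩ connEvent ends a₂ b))))

/-- **The one-edge cubic of the mirror (B)-term** in the Bernstein basis. -/
theorem crossB'_pin_cubic (p : E → R) (ends : E → Sym2 V) (o a₁ a₂ v b : V) (e : E) :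
    crossB p ends o a₂ a₁ v b =
      (1 - p e) ^ 3 * crossB (Function.update p e 0) ends o a₂ a₁ v b +
        p e * (1 - p e) ^ 2 * B1c p ends o a₁ a₂ v b e +
        (p e) ^ 2 * (1 - p e) * B2c p ends o a₁ a₂ v b e +
        (p e) ^ 3 * crossB (Function.update p e 1) ends o a₂ a₁ v b := by
  rw [crossB'_eq_poly p, crossB'_eq_poly (Function.update p e 0), crossB'_eq_poly (Function.update p e 1),
    prob_eq_pin p _ e, prob_eq_pin p _ e, prob_eq_pin p _ e, prob_eq_pin p _ e, prob_eq_pin p _ e,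
    prob_eq_pin p _ e, prob_eq_pin p _ e, prob_eq_pin p _ e]
  exact crossBPoly_pin _ _ _ _ _ _ _ _ _ _ _ _ _ _ _ _ _

end Masses

section PendantRoot

variable {V : Type*} {E : Type*} [Fintype E] [DecidableEq E] [Fintype V] [DecidableEq V]
  {R : Type*} [Field R] [LinearOrder R] [IsStrictOrderedRing R]
variable {ends : E → Sym2 V} {p : E → R} {e : E} {a₂ z : V}

omit [Fintype V] [DecidableEq V] [LinearOrder R] [IsStrictOrderedRing R] in
/-- The mirror (B)-term vanishes at the closed pin of a pendant root edge. -/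
theorem crossB'_closed_eq_zero (hleaf : ∀ f, a₂ ∈ ends f → f = e) {o a₁ v b : V} (hb : b ≠ a₂) :
    crossB (Function.update p e 0) ends o a₂ a₁ v b = 0 := by
  rw [crossB'_eq_poly, avoidAll_root_swap,
    prob_closed_eq_zero_of_subset hleaf hb (A := avoidAll ends a₂ {a₁} ∩ connEvent ends a₂ b) (fun _ h => h.2),
    prob_closed_eq_zero_of_subset hleaf hb
      (A := avoidAll ends a₂ {a₁} ∩ (connEvent ends a₁ o ∩ connEvent ends a₂ b)) (fun _ h => h.2.2),
    prob_closed_eq_zero_of_subset hleaf hb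
      (A := avoidAll ends a₂ {a₁} ∩ (connEvent ends a₁ v ∩ connEvent ends a₂ b)) (fun _ h => h.2.2),
    prob_closed_eq_zero_of_subset hleaf hb
      (A := avoidAll ends a₂ {a₁} ∩ (connEvent ends a₁ v ∩ (connEvent ends a₁ o ∩ connEvent ends a₂ b)))
      (fun _ h => h.2.2.2)]
  unfold crossBPoly
  ring

omit [Fintype V] [DecidableEq V] [IsStrictOrderedRing R] in
/-- **The dictionary for the mirror (B)-term**: its one-copy coefficient at a pendant root edge is
`crossB'fo` at the open pin. -/
theorem B1c_eq_crossB'fo (he : p e ≠ 1) (hleaf : ∀ f, a₂ ∈ ends f → f = e) (hends : ends e = s(a₂, z))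
    {o a₁ v b : V} (ho : o ≠ a₂) (h1 : a₁ ≠ a₂) (hv : v ≠ a₂) (hb : b ≠ a₂) :
    B1c p ends o a₁ a₂ v b e = crossB'fo (Function.update p e 1) ends o a₁ a₂ v b := by
  have fo : prob (Function.update p e 1) (connEvent ends a₁ o) =
      prob (Function.update p e 0) (connEvent ends a₁ o) :=
    KPrime.prob_update_one_eq_update_zero_of_flipInvAt he (KPrime.flipInvAt_connEvent hleaf hends h1 ho)
  have fv : prob (Function.update p e 1) (connEvent ends a₁ v) =
      prob (Function.update p e 0) (connEvent ends a₁ v) :=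
    KPrime.prob_update_one_eq_update_zero_of_flipInvAt he (KPrime.flipInvAt_connEvent hleaf hends h1 hv)
  have fvo : prob (Function.update p e 1) (connEvent ends a₁ v ∩ connEvent ends a₁ o) =
      prob (Function.update p e 0) (connEvent ends a₁ v ∩ connEvent ends a₁ o) :=
    KPrime.prob_update_one_eq_update_zero_of_flipInvAt he
      ((KPrime.flipInvAt_connEvent hleaf hends h1 hv).inter (KPrime.flipInvAt_connEvent hleaf hends h1 ho))
  unfold B1c crossB'fo
  rw [avoidAll_root_swap, closed_Q hleaf h1, closed_Q_inter hleaf h1 (connEvent ends a₁ o),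
    closed_Q_inter hleaf h1 (connEvent ends a₁ v),
    closed_Q_inter hleaf h1 (connEvent ends a₁ v ∩ connEvent ends a₁ o),
    prob_closed_eq_zero_of_subset hleaf hb (A := avoidAll ends a₂ {a₁} ∩ connEvent ends a₂ b) (fun _ h => h.2),
    prob_closed_eq_zero_of_subset hleaf hb
      (A := avoidAll ends a₂ {a₁} ∩ (connEvent ends a₁ o ∩ connEvent ends a₂ b)) (fun _ h => h.2.2),
    prob_closed_eq_zero_of_subset hleaf hb
      (A := avoidAll ends a₂ {a₁} ∩ (connEvent ends a₁ v ∩ connEvent ends a₂ b)) (fun _ h => h.2.2),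
    prob_closed_eq_zero_of_subset hleaf hb
      (A := avoidAll ends a₂ {a₁} ∩ (connEvent ends a₁ v ∩ (connEvent ends a₁ o ∩ connEvent ends a₂ b)))
      (fun _ h => h.2.2.2), ← fo, ← fv, ← fvo]
  unfold B1cPoly
  ring

/-- **The first-order mirror (B)-term is nonnegative at a pendant root** — theorem (B) at every
weight of the root edge, and the constant term of a quadratic nonnegative on `(0, 1]`. -/
theorem crossB'fo_nonneg_pendant_root (hp : IsProbVec p) (he : p e ≠ 1)
    (hleaf : ∀ f, a₂ ∈ ends f → f = e) (hends : ends e = s(a₂, z)) {o a₁ v b : V} (ho : o ≠ a₂)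
    (h1 : a₁ ≠ a₂) (hv : v ≠ a₂) (hb : b ≠ a₂) :
    0 ≤ crossB'fo (Function.update p e 1) ends o a₁ a₂ v b := by
  rw [← B1c_eq_crossB'fo he hleaf hends ho h1 hv hb]
  apply nonneg_of_quadratic_nonneg (b := B2c p ends o a₁ a₂ v b e)
    (c := crossB (Function.update p e 1) ends o a₂ a₁ v b)
  intro t ht0 ht1
  have hpt : IsProbVec (Function.update p e t) := hp.update e ht0.le ht1
  have hB := crossB_nonneg (Function.update p e t) ends hpt o a₂ a₁ v b
  rw [crossB'_pin_cubic (Function.update p e t) ends o a₁ a₂ v b e, Function.update_self,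
    Function.update_idem, Function.update_idem, crossB'_closed_eq_zero hleaf hb] at hB
  -- `B1c`, `B2c` of `p[e↦t]` are those of `p` (the pins agree)
  have hB1 : B1c (Function.update p e t) ends o a₁ a₂ v b e = B1c p ends o a₁ a₂ v b e := by
    unfold B1c; rw [Function.update_idem, Function.update_idem]
  have hB2 : B2c (Function.update p e t) ends o a₁ a₂ v b e = B2c p ends o a₁ a₂ v b e := by
    unfold B2c; rw [Function.update_idem, Function.update_idem]
  rw [hB1, hB2] at hB
  have ht : 0 ≤ t * ((B1c p ends o a₁ a₂ v b e) * (1 - t) ^ 2 +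
      B2c p ends o a₁ a₂ v b e * (t * (1 - t)) + crossB (Function.update p e 1) ends o a₂ a₁ v b * t ^ 2) := by
    nlinarith [hB]
  exact nonneg_of_mul_nonneg_right ht ht0

/-- **`B1h ≥ 0` at every pendant root edge**: the first-order (PROOT-½) is a theorem. -/
theorem B1h_nonneg_pendant_root (hp : IsProbVec p) (he : p e ≠ 1)
    (hleaf : ∀ f, a₂ ∈ ends f → f = e) (hends : ends e = s(a₂, z)) {o a₁ v b : V} (ho : o ≠ a₂)
    (h1 : a₁ ≠ a₂) (hv : v ≠ a₂) (hb : b ≠ a₂) :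
    0 ≤ B1h p ends o a₁ a₂ v b e :=
  B1h_nonneg_pendant_root_of_crossB'fo ends hp he hleaf hends ho h1 hv hb
    (crossB'fo_nonneg_pendant_root hp he hleaf hends ho h1 hv hb)

/-- **THE DEGREE-ONE-ROOT CONTRACTION OF ROW (LEAF-½), MODULO `B2h`**: at a pendant root edge
`e = {a₂, z}`, the row at the contraction (the open pin `a₂ := z`) together with `0 ≤ B2h` at the
edge gives the row at the pendant instance, for every weight of the edge. -/
theorem LeafRow_pendant_root_of_B2h (hp : IsProbVec p) (hleaf : ∀ f, a₂ ∈ ends f → f = e)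
    (hends : ends e = s(a₂, z)) {o a₁ v b : V} (ho : o ≠ a₂) (h1 : a₁ ≠ a₂) (hv : v ≠ a₂)
    (hb : b ≠ a₂) (h₁ : LeafRow (Function.update p e 1) ends o a₁ a₂ v b)
    (hB2 : 0 ≤ B2h p ends o a₁ a₂ v b e) : LeafRow p ends o a₁ a₂ v b := by
  by_cases he : p e = 1
  · rwa [Function.update_eq_self_iff.2 he.symm] at h₁
  · refine LeafRow_of_update_zero_of_bern p hp ends o a₁ a₂ v b e ?_ h₁
      (B1h_nonneg_pendant_root hp he hleaf hends ho h1 hv hb) hB2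
    unfold LeafRow
    rw [Rhalf_closed_pendant_eq_zero hleaf ho h1 hv hb]

end PendantRoot

end LeafRowPendantRootB

end Summit.Ventures.PercRepro2
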